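import Summits.CriticalPhenomena.SAWScalingLimit.Theses.SAWLeftRightFKG
import Summits.CriticalPhenomena.SAWScalingLimit.Theses.SAWTotalPositivity
import Summits.CriticalPhenomena.SAWScalingLimit.Theorems.FKGToTraversalBound.Negative.DeepEndpointGap

/-!
# Crux `FKGToTraversalBound` (stmt-CriticalPhenomena-1878) — what every uniform engine needs (lead c1, finding F-B)

Typed handles for the planner (workfile; the one `sorry` is the paper theorem F-B of
`Cruxes/FKGToTraversalBound/LeadFindings-c1.md`, not a registered stub).

* `CeilingBubbleBound` — the BOUNDARY (ceiling) critical bubble: the x_c-mass of self-avoiding chords between the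
  adjacent ceiling sites `u = (0,0) ∼ v = (1,0)` of an r2 carrier lying in the lower half-plane is bounded by an
  absolute constant.  By exhaustion of the lower half-plane by rooms this is `G^ℍ_{x_c}(0,e₁) < ∞` (generating function
  of half-plane self-avoiding polygons through a boundary edge); it is implied by `CriticalBubbleBound`
  (stmt-CriticalPhenomena-7117, `G_{x_c}(0,e₁) < ∞` on ℤ², open since Madras–Slade 1993 p. 22) and implies
  Hammond's theorem `Σ_n p_n μ^{-n} < ∞` (doi:10.1214/17-aop1182); its own status on ℤ² is open to our knowledge
  (on the hexagonal lattice it follows from the parafermionic identity, Duminil-Copin–Smirnov 2012).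
* `UniformPocketBound` — the common shape of the engine seeds of all five lines of this crux
  (`SAWCollarBound` of excursion-domination with its collar structure abstracted into a predicate `Adm` on
  `(carrier, H)`; `NeedleDiveBound`, `RootedDiveBound`, Kemppainen–Smirnov's Condition G2 for the SAW are of the
  same shape): ∃ η > 0, for every admissible `(C, a, b, H)`, `η · Z(a,b) ≤ Z_{avoid H}(a,b)`.
* `AcceptsNeckAndRoom Adm → UniformPocketBound Adm → CeilingBubbleBound` — F-B: if the admissibility
  predicate accepts the NECK-AND-ROOM carriers (corridor `y = 0`, neck `{0,1} × [-N,-1]`, an arbitrary hole-free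
  room below, `H` = lower neck + room; for `SAWCollarBound`: collar `r = δ`, `R = M δ` about `z₀ = δ(1/2, 0)`,
  every clause of `IsCollaredOff` holds and `Avoid H` is one-sided — checked by exact enumeration on 29- and
  188-chord instances), then the uniform pocket bound forces `Z_room(u,u') ≤ c₁ x_c^{-(L+L'+2N+2)} / η` for every
  room, i.e. `CeilingBubbleBound` (the chords of a ceiling carrier ARE the room chords: both graphs are induced).  PA cannot supply this (CARVE has the wrong sign along the exhaustion by
  rooms: enlarging a same-side pocket decreases `P(avoid H)`), so the repaired R1-crux, run through ANY uniform
  engine, is blocked on a boundary form of stmt-7117; an ANNEALED architecture (neck-building pasts are rare: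
  weight `≲ λ₂(x_c)^{ℓ/δ}` against room mass `≤ δ^{-1+o(1)}` by Hammond) is the way round.
-/

noncomputable section

open MeasureTheory Set
open scoped ENNReal
open Literature.Probability.LatticeModels Literature.Probability.RandomPlanarGeometry
open Summit.CriticalPhenomena.SAWScalingLimit.Theses.SAWLeftRightFKG
open Summit.CriticalPhenomena.SAWScalingLimit.Theorems.FKGToTraversalBound.Negative (dom lrLE)

namespace Summit.CriticalPhenomena.SAWScalingLimit.Cruxes.FKGToTraversalBound.EngineNeedsBubble

/-- **Ceiling (half-plane) critical bubble bound**: an absolute bound on the x_c-mass of chords between the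
adjacent sites `u = (0,0) ∼ v = (1,0)` of an r2 carrier at mesh `1` all of whose sites lie in the closed lower
half-plane (so `u, v` sit on the ceiling, adjacent to the boundary walk).  Exhausting the lower half-plane this is
`G^ℍ_{x_c}(0,e₁) < ∞`; mesh `1` is no loss (scaling, `LeftRightFKGStubMeshReduction`). -/
def CeilingBubbleBound : Prop :=
  ∃ K : ℝ≥0∞, K ≠ ⊤ ∧ ∀ (c : Site 2) (C : (zdGraph 2).Walk c c),
    (∀ p ∈ meshDomain (dom C 1) 1, p 1 ≤ 0) →
      SAW.weight (dom C 1) 1 ![0, 0] ![1, 0] Set.univ ≤ K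

/-- `CriticalBubbleBound` (stmt-7117: all bounded `Ω`, all `δ > 0`, all `u ∼ v`) implies the ceiling bubble
bound (r2 carriers are bounded: `Theorems.…ExcursionDomination.stub_domBounded`, p87093; restated here with the
boundedness as an input to keep this workfile import-light). -/
theorem ceilingBubble_of_criticalBubble
    (hdom : ∀ (c : Site 2) (C : (zdGraph 2).Walk c c) (δ : ℝ), Bornology.IsBounded (dom C δ))
    (h : Summit.CriticalPhenomena.SAWScalingLimit.Theses.SAWTotalPositivity.CriticalBubbleBound) :
    CeilingBubbleBound := by
  obtain ⟨K, hK, hB⟩ := h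
  refine ⟨K, hK, fun c C _ => hB (dom C 1) 1 _ _ (hdom c C 1) one_pos ?_⟩
  rw [zdGraph_adj_iff]
  refine ⟨0, Or.inl ?_⟩
  funext i
  fin_cases i <;> simp

/-- The chords of a carrier avoiding a set of sites. -/
def Avoid {Ω : Set ℂ} {δ : ℝ} {a b : Site 2} (H : Set (Site 2)) : Set (SAW.DomainSAW Ω δ a b) :=
  {γ | ∀ x ∈ γ.walk.support, x ∉ H}

/-- **Uniform pocket bound** for an admissibility predicate `Adm δ C a b H` on (carrier, pocket): the common
shape of `SAWCollarBound` (Adm = "H is one-sided and collared off by an annulus of modulus M, δ ≤ r"),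
`NeedleDiveBound`, `RootedDiveBound` and KS Condition G2 for the x_c-SAW. -/
def UniformPocketBound
    (Adm : ∀ (δ : ℝ) {c : Site 2}, (zdGraph 2).Walk c c → Site 2 → Site 2 → Set (Site 2) → Prop) : Prop :=
  ∃ η : ℝ, 0 < η ∧ ∀ (δ : ℝ) (c a b : Site 2) (C : (zdGraph 2).Walk c c) (H : Set (Site 2)),
    0 < δ → Adm δ C a b H →
      ENNReal.ofReal η * SAW.weight (dom C δ) δ a b Set.univ ≤ SAW.weight (dom C δ) δ a b (Avoid H)

/-- The NECK-AND-ROOM carriers (lattice units, mesh 1): corridor `{(x,0) : -L ≤ x ≤ L'}`, neck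
`{0,1} × [-N,-1]`, and a finite room `𝓡 ⊆ {y ≤ -N-1}` containing the ceiling pair `u = (0,-N-1) ∼ u' = (1,-N-1)`
and 4-connected; the pocket `H` = neck sites below depth `M` together with the room.  `Adm` ACCEPTS them if some
boundary walk `C` presents exactly this site set as `meshDomain (dom C 1) 1` (induced graph) with
`Adm 1 C (-L,0) (L',0) H`.  (For `SAWCollarBound` with modulus `M`: `N = ⌈M⌉ + 1`, collar `r = 1`, `R = M`,
`z₀ = (1/2, 0)` — all clauses verified in LeadFindings-c1.md §F-B.) -/
def AcceptsNeckAndRoom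
    (Adm : ∀ (δ : ℝ) {c : Site 2}, (zdGraph 2).Walk c c → Site 2 → Site 2 → Set (Site 2) → Prop) : Prop :=
  ∃ N : ℕ, ∀ (L L' : ℕ) (room : Finset (Site 2)),
    (∀ p ∈ room, p 1 + N + 1 ≤ 0) → (![0, -(N : ℤ) - 1] ∈ room) → (![1, -(N : ℤ) - 1] ∈ room) →
    ∃ (c : Site 2) (C : (zdGraph 2).Walk c c) (H : Set (Site 2)),
      (∀ p : Site 2, p ∈ meshDomain (dom C 1) 1 ↔
        ((p 1 = 0 ∧ -(L : ℤ) ≤ p 0 ∧ p 0 ≤ L') ∨ ((p 0 = 0 ∨ p 0 = 1) ∧ -(N : ℤ) ≤ p 1 ∧ p 1 ≤ -1) ∨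
          p ∈ room)) ∧
      (∀ p : Site 2, p ∈ room → p ∈ H) ∧ (∀ p ∈ H, p 1 ≤ -1) ∧
      Adm 1 C ![-(L : ℤ), 0] ![(L' : ℤ), 0] H

/-- **F-B (paper theorem, LeadFindings-c1.md; the only `sorry` of this workfile).**  A uniform pocket bound whose
admissibility predicate accepts the neck-and-room carriers forces the boundary critical bubble bound:
restricting `Z(a,b)` to the chords `a → (0,0) → column 0 of the neck → u → (any SAW of the room from u to u')
→ column 1 → (1,0) → b` gives `Z(a,b) ≥ x_c^{L+L'+2N+2} Z_room(u,u')`, while `Z_{avoid H}(a,b)` is a sum over the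
finitely many SAWs of corridor ∪ upper neck, each of weight `≤ 1`; the room is arbitrary, and every bounded
hole-free `Ω` with `u ∼ v` on its ceiling embeds.  Formalisation route: explicit boundary walk of the
neck-and-room site set (contour with slits), `DomainSAW` injection `ω ↦ prefix · ω · suffix` (`weight_eq_tsum_preimage`,
p85820), finiteness of the avoiding chords (`finite_domainSAW`), then exhaustion. -/
theorem boundaryBubble_of_uniformPocketBound
    (Adm : ∀ (δ : ℝ) {c : Site 2}, (zdGraph 2).Walk c c → Site 2 → Site 2 → Set (Site 2) → Prop)
    (hacc : AcceptsNeckAndRoom Adm) (h : UniformPocketBound Adm) : CeilingBubbleBound := by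
  sorry

end Summit.CriticalPhenomena.SAWScalingLimit.Cruxes.FKGToTraversalBound.EngineNeedsBubble

end
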